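import Literature.Geometry.Lorentzian.SpacetimeLocalConvergenceTransLemmas
import Literature.Geometry.Lorentzian.SpacetimeChartBridge
import Literature.Geometry.Lorentzian.ConvergenceTransport
import HarnessLib

/-!
# Time orientations along a `Cᵏ_loc`-convergent sequence of comparison maps
(topic `Geometry/Lorentzian`; the time-orientation clause of the diagonal datum
`LocalSubconvergence.trans`, Petersen 2006, Ch. 10, §3.2; O'Neill 1983, Ch. 5, Lemma 5.29 and
p. 145 (timecones))

Let `D : (𝓢ₙ, pₙ) ⇀ (𝓣, t)` be a pointed `Cᵏ_loc` subconvergence datum with comparison maps `φₙ`, and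
let `F : 𝓤 → 𝓣` be `C^∞` on an open set `O` containing a compact set `C`, sending the orienting
field `T_𝓤` at points of `C` to future-directed TIMELIKE vectors of `𝓣`. Then for all large `n` the
composites `φₙ ∘ F` send `T_𝓤` at every point of `C` to future-directed vectors of `𝓢ₙ`
(`LocalSubconvergence.eventually_isFutureDirected_mfderiv_comp`).

Mechanism (all in one chart `c'` of `𝓣` at a time, on finitely many compact pieces of `C`): with
`u = dF(T_𝓤 x)`, `T' = T_𝓣(F x)`, the pulled-back metric `hₙ = φₙ^* g_{𝓢ₙ}` differs from `g_𝓣` on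
`(a, b)` by at most `‖devₙ(c'(F x))‖ · ‖a‖_{c'} · ‖b‖_{c'}` (`abs_val_mfderiv_sub_val_le`,
coordinate images `‖·‖_{c'}` taken in `E4`), the
`C⁰` part of the deviation tends to `0` uniformly on the compact chart piece, and the three scalars
`g_𝓣(u,u)`, `g_𝓣(T',u)`, `g_𝓣(T',T')` are negative continuous functions of `x` on the compact
piece, hence `≤ −μ < 0`; so eventually `dφₙ u` and `dφₙ T'` are timelike with
`g(dφₙ T', dφₙ u) < 0`, `dφₙ T'` is future-directed (convergence datum), and `dφₙ u` lies in the
same timecone (`TimeOrientation.isFutureDirected_of_val_lt_zero`, O'Neill 1983, Ch. 5, p. 145).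

## References
* [Petersen2006] P. Petersen, *Riemannian Geometry*, 2nd ed., GTM 171, Springer 2006, Ch. 10, §3.2.
* [ONeill1983] B. O'Neill, *Semi-Riemannian Geometry*, Academic Press 1983, Ch. 5, Lemma 5.29,
  p. 145.
-/

noncomputable section

open TopologicalSpace Manifold Filter Topology Set Function Metric Bundle
open scoped ContDiff Topology ENNReal

universe u v w

namespace Literature.Geometry.Lorentzian

namespace Spacetime

/-! ### The time-orientation theorem -/

namespace LocalSubconvergence

variable {𝓢ₙ : ℕ → Spacetime.{u} 4} {pₙ : ∀ n, (𝓢ₙ n).carrier} {𝓣 : Spacetime.{v} 4}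
  {t : 𝓣.carrier} {k : ℕ} {𝓤 : Spacetime.{w} 4} {u : 𝓤.carrier}

/-- Arithmetic of the margins: `‖dev‖ < μ / (B² + 1)` and `‖V‖, ‖V'‖ ≤ B` give
`‖dev‖ ‖V‖ ‖V'‖ < μ`. [folklore] -/
theorem mul_mul_lt_of_lt_div {d a b B μ : ℝ} (hd : 0 ≤ d) (ha : 0 ≤ a) (hb : 0 ≤ b)
    (hμ : 0 < μ) (haB : a ≤ B) (hbB : b ≤ B) (hdμ : d < μ / (B ^ 2 + 1)) : d * a * b < μ := by
  have hB : 0 ≤ B := ha.trans haB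
  have h1 : d * a * b ≤ d * B * B := by gcongr
  have h2 : d * B * B ≤ μ / (B ^ 2 + 1) * B * B := by gcongr
  have h3 : μ / (B ^ 2 + 1) * B * B < μ := by
    rw [div_mul_eq_mul_div, div_mul_eq_mul_div, div_lt_iff₀ (by positivity)]
    nlinarith
  linarith

/-- **Time orientations along the composites, on one chart piece.** Let `D` be a subconvergence
datum `(𝓢ₙ, pₙ) ⇀ (𝓣, t)` with comparison maps `φₙ`, `F : 𝓤 → 𝓣` a map `C^∞` on an open `O`, and
`N` a compact set of points of `O` mapped by `F` into the chart source of `𝓣` at `x₀`, at which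
`dF(T_𝓤)` is future-directed and timelike. Then for all large `n`, `d(φₙ ∘ F)(T_𝓤 x)` is
future-directed in `𝓢ₙ` for every `x ∈ N` (mechanism in the module docstring).
[cite: ONeill1983, Ch. 5, p. 145] -/
theorem eventually_isFutureDirected_mfderiv_comp_of_piece (D : LocalSubconvergence 𝓢ₙ pₙ 𝓣 t k)
    {F : 𝓤.carrier → 𝓣.carrier} {O : Set 𝓤.carrier} (hO : IsOpen O)
    (hF : ContMDiffOn (𝓡 4) (𝓡 4) ∞ F O) (x₀ : 𝓣.carrier) {N : Set 𝓤.carrier} (hN : IsCompact N)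
    (hNO : N ⊆ O ∩ F ⁻¹' (chartAt E4 x₀).source)
    (hfut : ∀ x ∈ N, 𝓣.timeOrientation.IsFutureDirected
      (mfderiv (𝓡 4) (𝓡 4) F x (𝓤.timeOrientation.vectorField x)))
    (htl : ∀ x ∈ N, 𝓣.metric.IsTimelike
      (mfderiv (𝓡 4) (𝓡 4) F x (𝓤.timeOrientation.vectorField x))) :
    ∀ᶠ n in atTop, ∀ x ∈ N, (𝓢ₙ (D.sub n)).timeOrientation.IsFutureDirected
      (mfderiv (𝓡 4) (𝓡 4) (D.embed n ∘ F) x (𝓤.timeOrientation.vectorField x)) := by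
  set c := chartAt E4 x₀ with hc
  set O' : Set 𝓤.carrier := O ∩ F ⁻¹' c.source with hO'
  -- the coordinate quantities, as functions of `x`
  let y : 𝓤.carrier → E4 := fun x ↦ c (F x)
  let V : 𝓤.carrier → E4 := fun x ↦
    mfderiv (𝓡 4) 𝓘(ℝ, E4) (c ∘ F) x (𝓤.timeOrientation.vectorField x)
  let W : 𝓤.carrier → E4 := fun x ↦ 𝓣.timeOrientation.chartTime x₀ (F x)
  let m : 𝓤.carrier → E4 →L[ℝ] E4 →L[ℝ] ℝ := fun x ↦ 𝓣.metricInCoords c.symm (y x)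
  let α : 𝓤.carrier → ℝ := fun x ↦ m x (V x) (V x)
  let β : 𝓤.carrier → ℝ := fun x ↦ m x (W x) (V x)
  let γ : 𝓤.carrier → ℝ := fun x ↦ m x (W x) (W x)
  -- continuity on `N`
  have hVc : ContinuousOn V N :=
    (continuousOn_mfderiv_chartAt_comp_vectorField hO hF x₀).mono hNO
  have hWc : ContinuousOn W N := (continuousOn_chartTime_comp hF.continuousOn x₀).mono hNO
  have hmc : ContinuousOn m N := (continuousOn_metricInCoords_comp hF.continuousOn x₀).mono hNO
  have hαc : ContinuousOn α N := (hmc.clm_apply hVc).clm_apply hVc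
  have hβc : ContinuousOn β N := (hmc.clm_apply hWc).clm_apply hVc
  have hγc : ContinuousOn γ N := (hmc.clm_apply hWc).clm_apply hWc
  -- the identities at a point of `N`
  have hFd : ∀ x ∈ N, MDifferentiableAt (𝓡 4) (𝓡 4) F x := fun x hx ↦
    ((hF x (hNO hx).1).contMDiffAt (hO.mem_nhds (hNO hx).1)).mdifferentiableAt (by simp)
  have hz : ∀ x ∈ N, F x ∈ c.source := fun x hx ↦ (hNO hx).2
  have hVx : ∀ x ∈ N, V x = mfderiv (𝓡 4) 𝓘(ℝ, E4) c (F x)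
      (mfderiv (𝓡 4) (𝓡 4) F x (𝓤.timeOrientation.vectorField x)) := by
    intro x hx
    show mfderiv (𝓡 4) 𝓘(ℝ, E4) (c ∘ F) x (𝓤.timeOrientation.vectorField x) = _
    rw [mfderiv_comp x ((mdifferentiable_chart x₀).mdifferentiableAt (hz x hx)) (hFd x hx)]
    rfl
  have hWx : ∀ x ∈ N, W x = mfderiv (𝓡 4) 𝓘(ℝ, E4) c (F x)
      (𝓣.timeOrientation.vectorField (F x)) := fun x hx ↦ 𝓣.chartTime_eq_mfderiv (hz x hx)
  have hαx : ∀ x ∈ N, α x = 𝓣.metric.val (F x)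
      (mfderiv (𝓡 4) (𝓡 4) F x (𝓤.timeOrientation.vectorField x))
      (mfderiv (𝓡 4) (𝓡 4) F x (𝓤.timeOrientation.vectorField x)) := by
    intro x hx
    show 𝓣.metricInCoords c.symm (c (F x)) (V x) (V x) = _
    rw [hVx x hx, 𝓣.metricInCoords_chartAt_symm_apply_mfderiv (hz x hx)]
  have hβx : ∀ x ∈ N, β x = 𝓣.metric.val (F x) (𝓣.timeOrientation.vectorField (F x))
      (mfderiv (𝓡 4) (𝓡 4) F x (𝓤.timeOrientation.vectorField x)) := by
    intro x hx
    show 𝓣.metricInCoords c.symm (c (F x)) (W x) (V x) = _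
    rw [hVx x hx, hWx x hx, 𝓣.metricInCoords_chartAt_symm_apply_mfderiv (hz x hx)]
  have hγx : ∀ x ∈ N, γ x = 𝓣.metric.val (F x) (𝓣.timeOrientation.vectorField (F x))
      (𝓣.timeOrientation.vectorField (F x)) := by
    intro x hx
    show 𝓣.metricInCoords c.symm (c (F x)) (W x) (W x) = _
    rw [hWx x hx, 𝓣.metricInCoords_chartAt_symm_apply_mfderiv (hz x hx)]
  -- negativity
  have hαneg : ∀ x ∈ N, α x < 0 := fun x hx ↦ by rw [hαx x hx]; exact htl x hx
  have hβneg : ∀ x ∈ N, β x < 0 := fun x hx ↦ by rw [hβx x hx]; exact (hfut x hx).2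
  have hγneg : ∀ x ∈ N, γ x < 0 := fun x hx ↦ by
    rw [hγx x hx]; exact 𝓣.timeOrientation.isTimelike (F x)
  -- the empty piece is trivial
  rcases N.eq_empty_or_nonempty with hNe | hNne
  · exact Eventually.of_forall fun n x hx ↦ by simp [hNe] at hx
  -- a uniform margin `μ > 0`
  obtain ⟨μ, hμ, hαμ, hβμ, hγμ⟩ : ∃ μ : ℝ, 0 < μ ∧ (∀ x ∈ N, α x ≤ -μ) ∧ (∀ x ∈ N, β x ≤ -μ) ∧
      ∀ x ∈ N, γ x ≤ -μ := by
    let θ : 𝓤.carrier → ℝ := fun x ↦ max (α x) (max (β x) (γ x))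
    have hθc : ContinuousOn θ N := hαc.sup (hβc.sup hγc)
    obtain ⟨x₁, hx₁, hmax⟩ := hN.exists_isMaxOn hNne hθc
    have hθneg : θ x₁ < 0 := max_lt (hαneg x₁ hx₁) (max_lt (hβneg x₁ hx₁) (hγneg x₁ hx₁))
    refine ⟨-θ x₁, by linarith, fun x hx ↦ ?_, fun x hx ↦ ?_, fun x hx ↦ ?_⟩
    · have h := hmax hx; simp only [neg_neg]; exact (le_max_left _ _).trans h
    · have h := hmax hx; simp only [neg_neg]
      exact ((le_max_left _ _).trans (le_max_right _ _)).trans h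
    · have h := hmax hx; simp only [neg_neg]
      exact ((le_max_right _ _).trans (le_max_right _ _)).trans h
  -- a uniform bound `B` on the coordinate images
  obtain ⟨B, hVB, hWB⟩ : ∃ B : ℝ, (∀ x ∈ N, ‖V x‖ ≤ B) ∧ ∀ x ∈ N, ‖W x‖ ≤ B := by
    obtain ⟨B₁, hB₁⟩ := hN.exists_bound_of_continuousOn hVc
    obtain ⟨B₂, hB₂⟩ := hN.exists_bound_of_continuousOn hWc
    exact ⟨max B₁ B₂, fun x hx ↦ (hB₁ x hx).trans (le_max_left _ _),
      fun x hx ↦ (hB₂ x hx).trans (le_max_right _ _)⟩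
  set ε : ℝ := μ / (B ^ 2 + 1) with hε
  have hεpos : 0 < ε := div_pos hμ (by positivity)
  -- eventual containment and smallness of the deviation
  have hFN : IsCompact (F '' N) := hN.image_of_continuousOn (hF.continuousOn.mono fun x hx ↦ (hNO hx).1)
  have hK' : IsCompact (c '' (F '' N)) :=
    hFN.image_of_continuousOn (c.continuousOn.mono (by rintro _ ⟨x, hx, rfl⟩; exact hz x hx))
  have hK't : c '' (F '' N) ⊆ c.target := by
    rintro _ ⟨_, ⟨x, hx, rfl⟩, rfl⟩; exact c.map_source (hz x hx)
  have hE1 := D.eventually_subset_U hFN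
  have hE2 : ∀ᶠ n in atTop, supCkENorm (c '' (F '' N)) k (D.coordDeviation n x₀) <
      ENNReal.ofReal ε :=
    (tendsto_order.1 (D.tendsto_supCkENorm_coordDeviation x₀ hK' hK't)).2 _
      (ENNReal.ofReal_pos.2 hεpos)
  filter_upwards [hE1, hE2] with n hn1 hn2 x hx
  -- at the point `x`
  set z := F x with hzdef
  have hzs : z ∈ c.source := hz x hx
  have hzU : z ∈ D.U n := hn1 (mem_image_of_mem _ hx)
  have hG : MDifferentiableAt (𝓡 4) (𝓡 4) (D.embed n) z :=
    ((D.contMDiffOn_embed n z hzU).contMDiffAt ((D.U n).isOpen.mem_nhds hzU)).mdifferentiableAt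
      (by simp)
  set u : TangentSpace (𝓡 4) z := mfderiv (𝓡 4) (𝓡 4) F x (𝓤.timeOrientation.vectorField x)
    with hudef
  set T' : TangentSpace (𝓡 4) z := 𝓣.timeOrientation.vectorField z with hT'def
  -- the `C⁰` size of the deviation at `c z`
  have hdev : ‖chartDeviation (𝓢ₙ (D.sub n)) (D.embed n) x₀ (c z)‖ < ε := by
    have hmem : c z ∈ c '' (F '' N) := mem_image_of_mem _ (mem_image_of_mem _ hx)
    have hfin : supCkENorm (c '' (F '' N)) k (D.coordDeviation n x₀) ≠ ⊤ :=
      (hn2.trans ENNReal.ofReal_lt_top).ne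
    have h0 := norm_iteratedFDeriv_le_toReal_supCkENorm (Nat.zero_le k) hmem
      (D.coordDeviation n x₀) hfin
    rw [norm_iteratedFDeriv_zero] at h0
    exact h0.trans_lt (ENNReal.toReal_lt_of_lt_ofReal hn2)
  have hd0 : 0 ≤ ‖chartDeviation (𝓢ₙ (D.sub n)) (D.embed n) x₀ (c z)‖ :=
    ContinuousLinearMap.opNorm_nonneg _
  -- the three scalars of the pulled-back metric
  have hVeq : V x = mfderiv (𝓡 4) 𝓘(ℝ, E4) c z u := hVx x hx
  have hWeq : W x = mfderiv (𝓡 4) 𝓘(ℝ, E4) c z T' := hWx x hx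
  have huu := 𝓣.abs_val_mfderiv_sub_val_le hzs hG u u hVeq hVeq
  have hTu := 𝓣.abs_val_mfderiv_sub_val_le hzs hG T' u hWeq hVeq
  have hTT := 𝓣.abs_val_mfderiv_sub_val_le hzs hG T' T' hWeq hWeq
  have buu := mul_mul_lt_of_lt_div hd0 (norm_nonneg _) (norm_nonneg _) hμ (hVB x hx) (hVB x hx) hdev
  have bTu := mul_mul_lt_of_lt_div hd0 (norm_nonneg _) (norm_nonneg _) hμ (hWB x hx) (hVB x hx) hdev
  have bTT := mul_mul_lt_of_lt_div hd0 (norm_nonneg _) (norm_nonneg _) hμ (hWB x hx) (hWB x hx) hdev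
  have eα : 𝓣.metric.val z u u = α x := (hαx x hx).symm
  have eβ : 𝓣.metric.val z T' u = β x := (hβx x hx).symm
  have eγ : 𝓣.metric.val z T' T' = γ x := (hγx x hx).symm
  rw [eα] at huu; rw [eβ] at hTu; rw [eγ] at hTT
  have h1 : (𝓢ₙ (D.sub n)).metric.val (D.embed n z) (mfderiv (𝓡 4) (𝓡 4) (D.embed n) z u)
      (mfderiv (𝓡 4) (𝓡 4) (D.embed n) z u) < 0 := by
    have := (abs_sub_lt_iff.1 (huu.trans_lt buu)).1; linarith [hαμ x hx]
  have h2 : (𝓢ₙ (D.sub n)).metric.val (D.embed n z) (mfderiv (𝓡 4) (𝓡 4) (D.embed n) z T')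
      (mfderiv (𝓡 4) (𝓡 4) (D.embed n) z u) < 0 := by
    have := (abs_sub_lt_iff.1 (hTu.trans_lt bTu)).1; linarith [hβμ x hx]
  have h3 : (𝓢ₙ (D.sub n)).metric.val (D.embed n z) (mfderiv (𝓡 4) (𝓡 4) (D.embed n) z T')
      (mfderiv (𝓡 4) (𝓡 4) (D.embed n) z T') < 0 := by
    have := (abs_sub_lt_iff.1 (hTT.trans_lt bTT)).1; linarith [hγμ x hx]
  -- same timecone
  have hTfut := D.isFutureDirected_mfderiv_embed n z hzU
  have h1' : (𝓢ₙ (D.sub n)).metric.IsTimelike (mfderiv (𝓡 4) (𝓡 4) (D.embed n) z u) := h1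
  have h3' : (𝓢ₙ (D.sub n)).metric.IsTimelike (mfderiv (𝓡 4) (𝓡 4) (D.embed n) z T') := h3
  have hres : (𝓢ₙ (D.sub n)).timeOrientation.IsFutureDirected
      (mfderiv (𝓡 4) (𝓡 4) (D.embed n) z u) :=
    (𝓢ₙ (D.sub n)).timeOrientation.isFutureDirected_of_val_lt_zero hTfut h3' h1'.isCausal h2
  -- the chain rule
  rw [mfderiv_comp x hG (hFd x hx)]
  exact hres

/-- **Time orientations along the composites.** Let `D` be a subconvergence datum
`(𝓢ₙ, pₙ) ⇀ (𝓣, t)` with comparison maps `φₙ`, let `F : 𝓤 → 𝓣` be `C^∞` on an open set `O`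
containing the compact set `C`, and suppose that at every point of `C` the differential of `F` sends
the orienting field of `𝓤` to a future-directed TIMELIKE vector of `𝓣`. Then for all large `n`
the differential of `φₙ ∘ F` sends the orienting field of `𝓤` at every point of `C` to a
future-directed vector of `𝓢ₙ` (Petersen 2006, Ch. 10, §3.2: comparison maps of a pointed limit
can be chosen compatibly; O'Neill 1983, Ch. 5, p. 145, timecones). [cite: Petersen2006, Ch. 10 §3.2] -/
theorem eventually_isFutureDirected_mfderiv_comp (D : LocalSubconvergence 𝓢ₙ pₙ 𝓣 t k)
    {F : 𝓤.carrier → 𝓣.carrier} {O : Set 𝓤.carrier} (hO : IsOpen O)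
    (hF : ContMDiffOn (𝓡 4) (𝓡 4) ∞ F O) {C : Set 𝓤.carrier} (hC : IsCompact C) (hCO : C ⊆ O)
    (hfut : ∀ x ∈ C, 𝓣.timeOrientation.IsFutureDirected
      (mfderiv (𝓡 4) (𝓡 4) F x (𝓤.timeOrientation.vectorField x)))
    (htl : ∀ x ∈ C, 𝓣.metric.IsTimelike
      (mfderiv (𝓡 4) (𝓡 4) F x (𝓤.timeOrientation.vectorField x))) :
    ∀ᶠ n in atTop, ∀ x ∈ C, (𝓢ₙ (D.sub n)).timeOrientation.IsFutureDirected
      (mfderiv (𝓡 4) (𝓡 4) (D.embed n ∘ F) x (𝓤.timeOrientation.vectorField x)) := by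
  classical
  haveI : LocallyCompactSpace 𝓤.carrier := ChartedSpace.locallyCompactSpace E4 𝓤.carrier
  set Oc : 𝓣.carrier → Set 𝓤.carrier := fun x₀ ↦ O ∩ F ⁻¹' (chartAt E4 x₀).source with hOc
  have hOco : ∀ x₀, IsOpen (Oc x₀) := fun x₀ ↦
    hF.continuousOn.isOpen_inter_preimage hO (chartAt E4 x₀).open_source
  have hcov : C ⊆ ⋃ x₀, Oc x₀ := fun x hx ↦ mem_iUnion.2 ⟨F x, hCO hx, mem_chart_source E4 _⟩
  obtain ⟨S, N, hSN, hCS⟩ := exists_finset_isCompact_pieces hC Oc hOco hcov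
  have hpiece : ∀ y ∈ S, ∀ᶠ n in atTop, ∀ x ∈ C ∩ N y,
      (𝓢ₙ (D.sub n)).timeOrientation.IsFutureDirected
        (mfderiv (𝓡 4) (𝓡 4) (D.embed n ∘ F) x (𝓤.timeOrientation.vectorField x)) := by
    intro y hy
    obtain ⟨hNc, x₀, hNO⟩ := hSN y hy
    have h := D.eventually_isFutureDirected_mfderiv_comp_of_piece hO hF x₀
      (hC.inter_right (hNc.isClosed)) (inter_subset_right.trans hNO)
      (fun x hx ↦ hfut x hx.1) (fun x hx ↦ htl x hx.1)
    exact h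
  have hall := (eventually_all_finset S).2 hpiece
  filter_upwards [hall] with n hn x hx
  obtain ⟨y, hy, hxy⟩ := mem_iUnion₂.1 (hCS hx)
  exact hn y hy x ⟨hx, hxy⟩

/-! ### Eventual timelikeness of the images of the orienting field -/

/-- **The comparison maps eventually send the orienting field of the limit to TIMELIKE vectors,
uniformly on compact sets** (on one chart piece): for a datum `D : (𝓢ₙ, pₙ) ⇀ (𝓤, u)` and a compact
set `N` inside the chart source at `x₀`, for all large `n` and all `x ∈ N` the vector
`dφₙ(T_𝓤 x)` is timelike in `𝓢ₙ` — `φₙ^* gₙ → g_𝓤` uniformly on `N` in `C⁰` and `g_𝓤(T, T) ≤ −μ < 0`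
there. [cite: Petersen2006, Ch. 10 §3.2] -/
theorem eventually_isTimelike_mfderiv_embed_of_piece (D : LocalSubconvergence 𝓢ₙ pₙ 𝓤 u k)
    (x₀ : 𝓤.carrier) {N : Set 𝓤.carrier} (hN : IsCompact N) (hNs : N ⊆ (chartAt E4 x₀).source) :
    ∀ᶠ n in atTop, ∀ x ∈ N, (𝓢ₙ (D.sub n)).metric.IsTimelike
      (mfderiv (𝓡 4) (𝓡 4) (D.embed n) x (𝓤.timeOrientation.vectorField x)) := by
  set c := chartAt E4 x₀ with hc
  let W : 𝓤.carrier → E4 := fun x ↦ 𝓤.timeOrientation.chartTime x₀ x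
  let m : 𝓤.carrier → E4 →L[ℝ] E4 →L[ℝ] ℝ := fun x ↦ 𝓤.metricInCoords c.symm (c x)
  let γ : 𝓤.carrier → ℝ := fun x ↦ m x (W x) (W x)
  have hWc : ContinuousOn W N :=
    (𝓤.timeOrientation.contMDiffOn_chartTime (by exact_mod_cast le_top) x₀).continuousOn.mono hNs
  have hmc : ContinuousOn m N :=
    ((𝓤.contDiffOn_metricInCoords_chartAt_symm x₀).continuousOn.comp c.continuousOn
      (fun _ hx ↦ c.map_source hx)).mono hNs
  have hγc : ContinuousOn γ N := (hmc.clm_apply hWc).clm_apply hWc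
  have hWx : ∀ x ∈ N, W x = mfderiv (𝓡 4) 𝓘(ℝ, E4) c x (𝓤.timeOrientation.vectorField x) :=
    fun x hx ↦ 𝓤.chartTime_eq_mfderiv (hNs hx)
  have hγx : ∀ x ∈ N, γ x = 𝓤.metric.val x (𝓤.timeOrientation.vectorField x)
      (𝓤.timeOrientation.vectorField x) := by
    intro x hx
    show 𝓤.metricInCoords c.symm (c x) (W x) (W x) = _
    rw [hWx x hx, 𝓤.metricInCoords_chartAt_symm_apply_mfderiv (hNs hx)]
  have hγneg : ∀ x ∈ N, γ x < 0 := fun x hx ↦ by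
    rw [hγx x hx]; exact 𝓤.timeOrientation.isTimelike x
  rcases N.eq_empty_or_nonempty with hNe | hNne
  · exact Eventually.of_forall fun n x hx ↦ by simp [hNe] at hx
  obtain ⟨μ, hμ, hγμ⟩ : ∃ μ : ℝ, 0 < μ ∧ ∀ x ∈ N, γ x ≤ -μ := by
    obtain ⟨x₁, hx₁, hmax⟩ := hN.exists_isMaxOn hNne hγc
    exact ⟨-γ x₁, by linarith [hγneg x₁ hx₁], fun x hx ↦ by
      have h := hmax hx; simp only [neg_neg]; exact h⟩
  obtain ⟨B, hWB⟩ := hN.exists_bound_of_continuousOn hWc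
  set ε : ℝ := μ / (B ^ 2 + 1) with hε
  have hεpos : 0 < ε := div_pos hμ (by positivity)
  have hK' : IsCompact (c '' N) := hN.image_of_continuousOn (c.continuousOn.mono hNs)
  have hK't : c '' N ⊆ c.target := by rintro _ ⟨x, hx, rfl⟩; exact c.map_source (hNs hx)
  have hE1 := D.eventually_subset_U hN
  have hE2 : ∀ᶠ n in atTop, supCkENorm (c '' N) k (D.coordDeviation n x₀) < ENNReal.ofReal ε :=
    (tendsto_order.1 (D.tendsto_supCkENorm_coordDeviation x₀ hK' hK't)).2 _
      (ENNReal.ofReal_pos.2 hεpos)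
  filter_upwards [hE1, hE2] with n hn1 hn2 x hx
  have hxs : x ∈ c.source := hNs hx
  have hxU : x ∈ D.U n := hn1 hx
  have hG : MDifferentiableAt (𝓡 4) (𝓡 4) (D.embed n) x :=
    ((D.contMDiffOn_embed n x hxU).contMDiffAt ((D.U n).isOpen.mem_nhds hxU)).mdifferentiableAt
      (by simp)
  have hdev : ‖chartDeviation (𝓢ₙ (D.sub n)) (D.embed n) x₀ (c x)‖ < ε := by
    have hmem : c x ∈ c '' N := mem_image_of_mem _ hx
    have hfin : supCkENorm (c '' N) k (D.coordDeviation n x₀) ≠ ⊤ :=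
      (hn2.trans ENNReal.ofReal_lt_top).ne
    have h0 := norm_iteratedFDeriv_le_toReal_supCkENorm (Nat.zero_le k) hmem
      (D.coordDeviation n x₀) hfin
    rw [norm_iteratedFDeriv_zero] at h0
    exact h0.trans_lt (ENNReal.toReal_lt_of_lt_ofReal hn2)
  have hd0 : 0 ≤ ‖chartDeviation (𝓢ₙ (D.sub n)) (D.embed n) x₀ (c x)‖ :=
    ContinuousLinearMap.opNorm_nonneg _
  have hTT := 𝓤.abs_val_mfderiv_sub_val_le hxs hG (𝓤.timeOrientation.vectorField x)
    (𝓤.timeOrientation.vectorField x) (hWx x hx) (hWx x hx)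
  have bTT := mul_mul_lt_of_lt_div hd0 (norm_nonneg _) (norm_nonneg _) hμ (hWB x hx) (hWB x hx)
    hdev
  rw [← hγx x hx] at hTT
  show (𝓢ₙ (D.sub n)).metric.val (D.embed n x) _ _ < 0
  have := (abs_sub_lt_iff.1 (hTT.trans_lt bTT)).1
  linarith [hγμ x hx]

/-- **The comparison maps eventually send the orienting field of the limit to timelike vectors,
uniformly on every compact set.** [cite: Petersen2006, Ch. 10 §3.2] -/
theorem eventually_isTimelike_mfderiv_embed (D : LocalSubconvergence 𝓢ₙ pₙ 𝓤 u k)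
    {C : Set 𝓤.carrier} (hC : IsCompact C) :
    ∀ᶠ n in atTop, ∀ x ∈ C, (𝓢ₙ (D.sub n)).metric.IsTimelike
      (mfderiv (𝓡 4) (𝓡 4) (D.embed n) x (𝓤.timeOrientation.vectorField x)) := by
  classical
  haveI : LocallyCompactSpace 𝓤.carrier := ChartedSpace.locallyCompactSpace E4 𝓤.carrier
  obtain ⟨S, N, hSN, hCS⟩ := exists_finset_isCompact_pieces hC
    (fun x₀ : 𝓤.carrier ↦ (chartAt E4 x₀).source) (fun x₀ ↦ (chartAt E4 x₀).open_source)
    fun x _ ↦ mem_iUnion.2 ⟨x, mem_chart_source E4 x⟩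
  have hpiece : ∀ y ∈ S, ∀ᶠ n in atTop, ∀ x ∈ N y, (𝓢ₙ (D.sub n)).metric.IsTimelike
      (mfderiv (𝓡 4) (𝓡 4) (D.embed n) x (𝓤.timeOrientation.vectorField x)) := by
    intro y hy
    obtain ⟨hNc, x₀, hNs⟩ := hSN y hy
    exact D.eventually_isTimelike_mfderiv_embed_of_piece x₀ hNc hNs
  filter_upwards [(eventually_all_finset S).2 hpiece] with n hn x hx
  obtain ⟨y, hy, hxy⟩ := mem_iUnion₂.1 (hCS hx)
  exact hn y hy x hxy

end LocalSubconvergence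

end Spacetime

end Literature.Geometry.Lorentzian
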